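import Summits.QuantumAdvantage.QuantumAdvantage.Theorems.CubicForrelationNearExactIsExactCubicFormR4PartnerAssembly
import Summits.QuantumAdvantage.QuantumAdvantage.Theorems.CubicForrelationNearExactIsExactCubicFormR4ZReduce
import Summits.QuantumAdvantage.QuantumAdvantage.Theorems.CubicForrelationNearExactIsExactCubicFormR4LevelOne
import Summits.QuantumAdvantage.QuantumAdvantage.Theorems.CubicForrelationNearExactIsExactCubicFormR4LevelTwo

/-!
# Crux `CubicForrelation.NearExactIsExact` (stmt-QuantumAdvantage-14043) — n = 12, E1280-even: the RANK-4 HALF `HR4` PROVED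

Certificate seat `b2b-cforr-cert` (gen 43).  HONEST FRAMING: kernel-checked finite-slice theorem (standard axioms) about 12-bit cubics:
`tpw_HR4` — a cubic `κ` on `𝔽₂¹²` with a symmetric pairing partner for its cubic form (`Σ_{j<k} c_pjk d_φjk = [p = φ]`) and a direction of
light derivative (`#{κ ⊕ κ(·⊕a) = 1} = 1536`) has at least `1280` ones.  It is literally hypothesis `HR4` of
`theta_twelve_eq_57_64_of_R4` (…CubicFormR2LowAssembly, cert seat g42) and is assembled from the three branches of the R4 dispatch
(…CubicFormR4PartnerAssembly `tpw_HR4_of_branches`, `tpw_R4_HL_of_levels`): `HZ` (…CubicFormR4ZReduce `tpw_R4_zero`), `HL 1`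
(…CubicFormR4LevelOne `tpw_R4_level_one`) and `HL 2` (…CubicFormR4LevelTwo `tpw_R4_level_two`).  This completes R4-PARTNER.md /
E1280-HANDPROOFS §2 in Lean.  Nothing about the summit; `θ₁₂ = 57/64` follows once the R2 half is in the tree (…TwelveTheta5764).
NOT summit progress.

References: this seat lineage (g36–g43).  Axioms: the standard three.
-/

set_option linter.dupNamespace false -- D-0017: single-problem summit ⇒ `QuantumAdvantage.QuantumAdvantage` by design

namespace Summit.QuantumAdvantage.QuantumAdvantage.Theorems.CubicForrelation.NearExactIsExact

open Finset
open Literature.Computability.QuantumComplexity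
open Literature.Computability.QuantumComplexity.BuzetChailloux (bxor zeroVec)

/-- **The rank-4 half of E1280-even** (`HR4` of `theta_twelve_eq_57_64_of_R4`).  See the module docstring. [this work] -/
theorem tpw_HR4 :
    ∀ (κ : (Fin (6 + 6) → Bool) → Bool), IsDegLeFun 3 κ →
      ∀ (c d : Fin (6 + 6) → Fin (6 + 6) → Fin (6 + 6) → ZMod 2),
      (∀ p j k, c p k j = c p j k) → (∀ p j k, c j p k = c p j k) → (∀ p j, c p j j = 0) →
      (∀ φ j k, d φ j k =
        if ((((κ zeroVec ^^ κ (bxor zeroVec (fun l => decide (l = k)))) ^^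
                (κ (bxor zeroVec (fun l => decide (l = j))) ^^ κ (bxor (bxor zeroVec (fun l => decide (l = j))) (fun l => decide (l = k))))) ^^
              ((κ (bxor zeroVec (fun l => decide (l = φ))) ^^ κ (bxor (bxor zeroVec (fun l => decide (l = φ))) (fun l => decide (l = k)))) ^^
                (κ (bxor (bxor zeroVec (fun l => decide (l = φ))) (fun l => decide (l = j))) ^^
                  κ (bxor (bxor (bxor zeroVec (fun l => decide (l = φ))) (fun l => decide (l = j))) (fun l => decide (l = k))))))) = true
        then 1 else 0) →
      (∀ p φ, (∑ j, ∑ k, (if j < k then c p j k * d φ j k else 0)) = if p = φ then 1 else 0) →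
      ∀ a : Fin (6 + 6) → Bool, a ≠ zeroVec → #(univ.filter fun x => (κ x ^^ κ (bxor x a)) = true) = 1536 →
      1280 ≤ #(univ.filter fun x : Fin (6 + 6) → Bool => κ x = true) :=
  tpw_HR4_of_branches tpw_R4_zero (tpw_R4_HL_of_levels tpw_R4_level_one tpw_R4_level_two)

end Summit.QuantumAdvantage.QuantumAdvantage.Theorems.CubicForrelation.NearExactIsExact
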